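import Summits.CriticalPhenomena.PercolationContinuityZ3.Theorems.PercNearOneGluingNoHeavyLowerTailThreePointHalvingResample
import Literature.Probability.Percolation.DecisionTreeTwoConfig
import HarnessLib

/-!
# The halving lemma (v) from a POINTWISE COVER of the resampling premise by Gladkov hybrids (Sahi programme, prover prim-sahi-p2 gen 48)

Support file (`--supports stmt-CriticalPhenomena-4575`, helper).  No definitions, no named facts, no sorries; standard axioms.
Memo `run/shared/lean/prim/prim-sahi/FROM-prim-sahi-p2-gen48-HYBRIDS.md` §0(2), §1; `prim-sahi-p2/PROOF-E3.md` §58(c).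

SETTING.  `μ = prodBernoulli w` on a finite vertex type, vertices `s, a, c`; `U = {s↔a} ∪ {c↔a}`, `D = {s↮c}`, `X = U ∩ D = sa|c ⊔ ac|s`,
`Ī = {a↮s} ∩ {a↮c}`, `SC = {s↔c}`, `s|a|c = Ī ∩ SCᶜ`.  Gen 47 (`HalvingResample.sum_notU_mul_sum_conn_eq`) wrote the Harris gap of (v) as a two-copy
sum: with `K, C` independent configurations and `H(K,C) := splice (revealedAt univ ∅ a K) C K` ("`C` on the pairs revealed by the cluster exploration of `a`
in `K`, `K` elsewhere" — Gladkov's swap), `μ(Ī)·μ(SC) = Σ_K Σ_C wtW K·wtW C·1_Ī(K)·1_SC(H(K,C))`, and (v) ⟺ the part of this sum with `K ∈ s|a|c` is `≤ μ(X)`.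

THE COVERING PRINCIPLE (this file).  Let `Φ₁, Φ₂` be maps from pairs of configurations to configurations whose push-forward of the pair law is the
one-configuration law (`hΦ : Σ_x wt2W x·g(Φ x) = Σ_K wtW K·g K` for every `g`) — e.g. the first component `C₁ →_S C₂` of the swap of ANY valid two-configuration
decision tree (Gladkov 2024 Lemma 3.1, tree `DecisionTree.DTree2.sum_wt2W_comp_swap2`).  If POINTWISE
`K ∈ s|a|c ∧ H(K,C) ∈ SC ⟹ Φ₁(K,C) ∈ sa|c ∨ Φ₂(K,C) ∈ ac|s`, then `μ(U)·μ(D) ≤ 2·μ(U ∩ D)`: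
* `sum_notU_mul_sum_conn_le_of_cover` — `μ(Ī)μ(SC) ≤ μ(Ī∩SC) + μ(sa|c) + μ(ac|s)` in finite-sum form (pointwise split + the push-forward hypothesis);
* **`halvingUD_of_cover`** — the halving lemma (v) under the abstract cover hypothesis;
* **`halvingUD_of_treeCover`** — the same for two valid decision trees `T₁, T₂ : DTree2 (Sym2 V)` with `Φᵢ = (swap2 Tᵢ ·).1`;
* `halvingUD_of_treeCoverX` — one tree landing in `X`.
So a purely COMBINATORIAL statement — the existence, for every finite graph and every `s, a, c`, of two decision trees covering the premise — would
prove (v) on every weighted graph; the J-part of the premise is covered by the two trees of Gladkov–Zimin's Lemma 7.1 (tree `Gladkov.lemma_7_1`), and an exact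
game-DP finds covering (synchronized) pairs on every graph tested (memo §0(3)).  Nothing here asserts that such trees exist in general.
[cite: Gladkov2024, Def. 2.3–2.4, Lemma 3.1 (arXiv:2408.08457)]; [cite: GladkovZimin2024, Lemma 4.2, Lemma 7.1 = "key observation" of §4 (arXiv:2404.08873)].
-/

noncomputable section

open Classical

namespace Summit.CriticalPhenomena.PercolationContinuityZ3.Theorems

namespace HalvingTreeCover

open Finset MeasureTheory
open Literature.Probability.Percolation Literature.Probability.Percolation.DecisionTree
open Literature.Probability.Percolation.DecisionTree.DTree2
open Literature.Probability.Percolation.TargetExploration Literature.Probability.Percolation.ClusterConditioning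
open Literature.Probability.LatticeModels

variable {V : Type*} [Fintype V]

/-- **The resampling bound from a pointwise cover**: if every pair `(K, C)` with `K ∈ s|a|c` and `s ↔ c` in the hybrid `H(K,C)` is sent by `Φ₁` into
`sa|c` or by `Φ₂` into `ac|s`, and `Φ₁, Φ₂` push the pair law forward to the configuration law, then
`μ(Ī)·μ(SC) ≤ μ(Ī ∩ SC) + μ(sa|c) + μ(ac|s)` (finite-sum form, `p_e = w_e ∈ [0,1]`). [this work] -/
theorem sum_notU_mul_sum_conn_le_of_cover {p : Sym2 V → ℝ} (hp0 : ∀ e, 0 ≤ p e) (hp1 : ∀ e, p e ≤ 1) (s a c : V)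
    (Φ₁ Φ₂ : Finset (Sym2 V) × Finset (Sym2 V) → Finset (Sym2 V))
    (hΦ₁ : ∀ g : Finset (Sym2 V) → ℝ,
      ∑ x ∈ (Finset.univ : Finset (Sym2 V)).powerset ×ˢ (Finset.univ : Finset (Sym2 V)).powerset, wt2W Finset.univ p x * g (Φ₁ x) =
        ∑ K ∈ (Finset.univ : Finset (Sym2 V)).powerset, wtW Finset.univ p K * g K)
    (hΦ₂ : ∀ g : Finset (Sym2 V) → ℝ,
      ∑ x ∈ (Finset.univ : Finset (Sym2 V)).powerset ×ˢ (Finset.univ : Finset (Sym2 V)).powerset, wt2W Finset.univ p x * g (Φ₂ x) =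
        ∑ K ∈ (Finset.univ : Finset (Sym2 V)).powerset, wtW Finset.univ p K * g K)
    (hcov : ∀ K C : Finset (Sym2 V),
      ¬ (openGraph (↑K : Set (Sym2 V))).Reachable a s → ¬ (openGraph (↑K : Set (Sym2 V))).Reachable a c →
        ¬ (openGraph (↑K : Set (Sym2 V))).Reachable s c →
      (openGraph (↑(splice (revealedAt (Finset.univ : Finset (Sym2 V)) (∅ : Finset V) a K) C K) : Set (Sym2 V))).Reachable s c →
        ((openGraph (↑(Φ₁ (K, C)) : Set (Sym2 V))).Reachable s a ∧ ¬ (openGraph (↑(Φ₁ (K, C)) : Set (Sym2 V))).Reachable s c) ∨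
        ((openGraph (↑(Φ₂ (K, C)) : Set (Sym2 V))).Reachable c a ∧ ¬ (openGraph (↑(Φ₂ (K, C)) : Set (Sym2 V))).Reachable c s)) :
    (∑ K ∈ (Finset.univ : Finset (Sym2 V)).powerset, wtW Finset.univ p K *
        ind {K : Finset (Sym2 V) | ¬ (openGraph (↑K : Set (Sym2 V))).Reachable a s ∧
          ¬ (openGraph (↑K : Set (Sym2 V))).Reachable a c} K) *
      (∑ C ∈ (Finset.univ : Finset (Sym2 V)).powerset, wtW Finset.univ p C *
        ind {C : Finset (Sym2 V) | (openGraph (↑C : Set (Sym2 V))).Reachable s c} C) ≤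
    (∑ K ∈ (Finset.univ : Finset (Sym2 V)).powerset, wtW Finset.univ p K *
        ind {K : Finset (Sym2 V) | (¬ (openGraph (↑K : Set (Sym2 V))).Reachable a s ∧
          ¬ (openGraph (↑K : Set (Sym2 V))).Reachable a c) ∧ (openGraph (↑K : Set (Sym2 V))).Reachable s c} K) +
    ((∑ K ∈ (Finset.univ : Finset (Sym2 V)).powerset, wtW Finset.univ p K *
        ind {K : Finset (Sym2 V) | (openGraph (↑K : Set (Sym2 V))).Reachable s a ∧ ¬ (openGraph (↑K : Set (Sym2 V))).Reachable s c} K) +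
      (∑ K ∈ (Finset.univ : Finset (Sym2 V)).powerset, wtW Finset.univ p K *
        ind {K : Finset (Sym2 V) | (openGraph (↑K : Set (Sym2 V))).Reachable c a ∧ ¬ (openGraph (↑K : Set (Sym2 V))).Reachable c s} K)) := by
  set Dm : Finset (Sym2 V) := Finset.univ with hD
  set Ib : Set (Finset (Sym2 V)) := {K | ¬ (openGraph (↑K : Set (Sym2 V))).Reachable a s ∧
      ¬ (openGraph (↑K : Set (Sym2 V))).Reachable a c} with hIb
  set SC : Set (Finset (Sym2 V)) := {C | (openGraph (↑C : Set (Sym2 V))).Reachable s c} with hSC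
  set J3 : Set (Finset (Sym2 V)) := {K | (¬ (openGraph (↑K : Set (Sym2 V))).Reachable a s ∧
      ¬ (openGraph (↑K : Set (Sym2 V))).Reachable a c) ∧ (openGraph (↑K : Set (Sym2 V))).Reachable s c} with hJ3
  set P1s : Set (Finset (Sym2 V)) := {K | (openGraph (↑K : Set (Sym2 V))).Reachable s a ∧
      ¬ (openGraph (↑K : Set (Sym2 V))).Reachable s c} with hP1s
  set P2s : Set (Finset (Sym2 V)) := {K | (openGraph (↑K : Set (Sym2 V))).Reachable c a ∧
      ¬ (openGraph (↑K : Set (Sym2 V))).Reachable c s} with hP2s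
  rw [HalvingResample.sum_notU_mul_sum_conn_eq p s a c]
  -- pointwise bound of the integrand
  have hpt : ∀ K C : Finset (Sym2 V),
      ind Ib K * ind SC (splice (revealedAt Dm (∅ : Finset V) a K) C K) ≤
        ind J3 K + (ind P1s (Φ₁ (K, C)) + ind P2s (Φ₂ (K, C))) := by
    intro K C
    have h10 : 0 ≤ ind P1s (Φ₁ (K, C)) := by unfold ind; split_ifs <;> norm_num
    have h20 : 0 ≤ ind P2s (Φ₂ (K, C)) := by unfold ind; split_ifs <;> norm_num
    have hJ0 : 0 ≤ ind J3 K := by unfold ind; split_ifs <;> norm_num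
    have hS1 : ind SC (splice (revealedAt Dm (∅ : Finset V) a K) C K) ≤ 1 := by unfold ind; split_ifs <;> norm_num
    by_cases hK : K ∈ Ib
    · rw [ind_of_mem hK, one_mul]
      by_cases hKsc : (openGraph (↑K : Set (Sym2 V))).Reachable s c
      · have hJ : K ∈ J3 := ⟨hK, hKsc⟩
        rw [ind_of_mem hJ]
        linarith
      · by_cases hθ : splice (revealedAt Dm (∅ : Finset V) a K) C K ∈ SC
        · have hθ' : (openGraph (↑(splice (revealedAt Dm (∅ : Finset V) a K) C K) : Set (Sym2 V))).Reachable s c := hθ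
          rcases hcov K C hK.1 hK.2 hKsc hθ' with h1 | h2
          · have : Φ₁ (K, C) ∈ P1s := h1
            rw [ind_of_mem hθ, ind_of_mem this]
            linarith
          · have : Φ₂ (K, C) ∈ P2s := h2
            rw [ind_of_mem hθ, ind_of_mem this]
            linarith
        · rw [ind_of_not_mem hθ]; linarith
    · rw [ind_of_not_mem hK, zero_mul]; linarith
  -- sum it up
  have hw0 : ∀ K : Finset (Sym2 V), 0 ≤ wtW Dm p K := fun K => wtW_nonneg Dm hp0 hp1 K
  have hsum1 : ∑ K ∈ Dm.powerset, ∑ C ∈ Dm.powerset, wtW Dm p K * wtW Dm p C * ind P1s (Φ₁ (K, C)) =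
      ∑ K ∈ Dm.powerset, wtW Dm p K * ind P1s K := by
    rw [← hΦ₁ (ind P1s), ← Finset.sum_product']
    refine Finset.sum_congr rfl fun x _ => ?_
    simp only [wt2W]
  have hsum2 : ∑ K ∈ Dm.powerset, ∑ C ∈ Dm.powerset, wtW Dm p K * wtW Dm p C * ind P2s (Φ₂ (K, C)) =
      ∑ K ∈ Dm.powerset, wtW Dm p K * ind P2s K := by
    rw [← hΦ₂ (ind P2s), ← Finset.sum_product']
    refine Finset.sum_congr rfl fun x _ => ?_
    simp only [wt2W]
  calc ∑ K ∈ Dm.powerset, ∑ C ∈ Dm.powerset, wtW Dm p K * wtW Dm p C *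
          (ind Ib K * ind SC (splice (revealedAt Dm (∅ : Finset V) a K) C K))
      ≤ ∑ K ∈ Dm.powerset, ∑ C ∈ Dm.powerset, wtW Dm p K * wtW Dm p C *
          (ind J3 K + (ind P1s (Φ₁ (K, C)) + ind P2s (Φ₂ (K, C)))) := by
        refine Finset.sum_le_sum fun K _ => Finset.sum_le_sum fun C _ => ?_
        exact mul_le_mul_of_nonneg_left (hpt K C) (mul_nonneg (hw0 K) (hw0 C))
    _ = (∑ K ∈ Dm.powerset, wtW Dm p K * ind J3 K) * (∑ C ∈ Dm.powerset, wtW Dm p C) +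
          (∑ K ∈ Dm.powerset, ∑ C ∈ Dm.powerset, wtW Dm p K * wtW Dm p C * ind P1s (Φ₁ (K, C)) +
            ∑ K ∈ Dm.powerset, ∑ C ∈ Dm.powerset, wtW Dm p K * wtW Dm p C * ind P2s (Φ₂ (K, C))) := by
        rw [Finset.sum_mul_sum, ← Finset.sum_add_distrib, ← Finset.sum_add_distrib]
        refine Finset.sum_congr rfl fun K _ => ?_
        rw [← Finset.sum_add_distrib, ← Finset.sum_add_distrib]
        refine Finset.sum_congr rfl fun C _ => ?_
        ring
    _ = _ := by rw [sum_wtW, mul_one, hsum1, hsum2]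

/-- **THE HALVING LEMMA (v) FROM A POINTWISE COVER.**  `μ = prodBernoulli w`, `U = {s↔a} ∪ {c↔a}`, `D = {s↮c}`.  If two law-preserving maps `Φ₁, Φ₂`
of pairs of configurations (e.g. Gladkov tree hybrids) send every pair `(K, C)` with `K ∈ s|a|c` and `s ↔ c` after Gladkov's swap along the cluster of `a`
into `sa|c` (for `Φ₁`) or `ac|s` (for `Φ₂`), then `μ(U)·μ(D) ≤ 2·μ(U ∩ D)`.  Proof: `μ(U)μ(D) − 2μ(U∩D) = [μ(Ī)μ(SC) − μ(Ī∩SC)] − μ(U∩D)` and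
`μ(U∩D) = μ(sa|c) + μ(ac|s)`. [this work] -/
theorem halvingUD_of_cover (w : Sym2 V → unitInterval) (s a c : V)
    (Φ₁ Φ₂ : Finset (Sym2 V) × Finset (Sym2 V) → Finset (Sym2 V))
    (hΦ₁ : ∀ g : Finset (Sym2 V) → ℝ,
      ∑ x ∈ (Finset.univ : Finset (Sym2 V)).powerset ×ˢ (Finset.univ : Finset (Sym2 V)).powerset,
          wt2W Finset.univ (fun e => (w e : ℝ)) x * g (Φ₁ x) =
        ∑ K ∈ (Finset.univ : Finset (Sym2 V)).powerset, wtW Finset.univ (fun e => (w e : ℝ)) K * g K)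
    (hΦ₂ : ∀ g : Finset (Sym2 V) → ℝ,
      ∑ x ∈ (Finset.univ : Finset (Sym2 V)).powerset ×ˢ (Finset.univ : Finset (Sym2 V)).powerset,
          wt2W Finset.univ (fun e => (w e : ℝ)) x * g (Φ₂ x) =
        ∑ K ∈ (Finset.univ : Finset (Sym2 V)).powerset, wtW Finset.univ (fun e => (w e : ℝ)) K * g K)
    (hcov : ∀ K C : Finset (Sym2 V),
      ¬ (openGraph (↑K : Set (Sym2 V))).Reachable a s → ¬ (openGraph (↑K : Set (Sym2 V))).Reachable a c →
        ¬ (openGraph (↑K : Set (Sym2 V))).Reachable s c →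
      (openGraph (↑(splice (revealedAt (Finset.univ : Finset (Sym2 V)) (∅ : Finset V) a K) C K) : Set (Sym2 V))).Reachable s c →
        ((openGraph (↑(Φ₁ (K, C)) : Set (Sym2 V))).Reachable s a ∧ ¬ (openGraph (↑(Φ₁ (K, C)) : Set (Sym2 V))).Reachable s c) ∨
        ((openGraph (↑(Φ₂ (K, C)) : Set (Sym2 V))).Reachable c a ∧ ¬ (openGraph (↑(Φ₂ (K, C)) : Set (Sym2 V))).Reachable c s)) :
    (prodBernoulli w).real (openConn s a ∪ openConn c a) * (prodBernoulli w).real ((openConn s c)ᶜ) ≤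
      2 * (prodBernoulli w).real ((openConn s a ∪ openConn c a) ∩ (openConn s c)ᶜ) := by
  set Dm : Finset (Sym2 V) := Finset.univ with hD
  set p : Sym2 V → ℝ := fun e => (w e : ℝ) with hp
  have hp0 : ∀ e, 0 ≤ p e := fun e => (w e).2.1
  have hp1 : ∀ e, p e ≤ 1 := fun e => (w e).2.2
  have hdet : ∀ E : Set (BondConfig V), DeterminedBy E (↑Dm : Set (Sym2 V)) := by
    intro E
    rw [determinedBy_iff]
    intro ω ω' h
    rw [hD, Finset.coe_univ, Set.inter_univ, Set.inter_univ] at h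
    rw [h]
  set U : Set (BondConfig V) := openConn s a ∪ openConn c a with hU
  set Dv : Set (BondConfig V) := (openConn s c)ᶜ with hDv
  have eU : (prodBernoulli w).real U = ∑ K ∈ Dm.powerset, wtW Dm p K * ind {K : Finset (Sym2 V) | (↑K : Set (Sym2 V)) ∈ U} K := by
    rw [DecisionTree.prodBernoulli_real_eq_PrW w (hdet U) (X := {K : Finset (Sym2 V) | (↑K : Set (Sym2 V)) ∈ U})
      (fun S _ => Iff.rfl), PrW_eq_sum_ind]
  have eD : (prodBernoulli w).real Dv = ∑ K ∈ Dm.powerset, wtW Dm p K * ind {K : Finset (Sym2 V) | (↑K : Set (Sym2 V)) ∈ Dv} K := by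
    rw [DecisionTree.prodBernoulli_real_eq_PrW w (hdet Dv) (X := {K : Finset (Sym2 V) | (↑K : Set (Sym2 V)) ∈ Dv})
      (fun S _ => Iff.rfl), PrW_eq_sum_ind]
  have eX : (prodBernoulli w).real (U ∩ Dv) =
      ∑ K ∈ Dm.powerset, wtW Dm p K * ind {K : Finset (Sym2 V) | (↑K : Set (Sym2 V)) ∈ U ∩ Dv} K := by
    rw [DecisionTree.prodBernoulli_real_eq_PrW w (hdet (U ∩ Dv)) (X := {K : Finset (Sym2 V) | (↑K : Set (Sym2 V)) ∈ U ∩ Dv})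
      (fun S _ => Iff.rfl), PrW_eq_sum_ind]
  set Ib : Set (Finset (Sym2 V)) := {K | ¬ (openGraph (↑K : Set (Sym2 V))).Reachable a s ∧
      ¬ (openGraph (↑K : Set (Sym2 V))).Reachable a c} with hIb
  set SC : Set (Finset (Sym2 V)) := {C | (openGraph (↑C : Set (Sym2 V))).Reachable s c} with hSC
  set J3 : Set (Finset (Sym2 V)) := {K | (¬ (openGraph (↑K : Set (Sym2 V))).Reachable a s ∧
      ¬ (openGraph (↑K : Set (Sym2 V))).Reachable a c) ∧ (openGraph (↑K : Set (Sym2 V))).Reachable s c} with hJ3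
  set P1s : Set (Finset (Sym2 V)) := {K | (openGraph (↑K : Set (Sym2 V))).Reachable s a ∧
      ¬ (openGraph (↑K : Set (Sym2 V))).Reachable s c} with hP1s
  set P2s : Set (Finset (Sym2 V)) := {K | (openGraph (↑K : Set (Sym2 V))).Reachable c a ∧
      ¬ (openGraph (↑K : Set (Sym2 V))).Reachable c s} with hP2s
  have hmemU : ∀ K : Finset (Sym2 V), K ∈ {K : Finset (Sym2 V) | (↑K : Set (Sym2 V)) ∈ U} ↔ K ∉ Ib := by
    intro K
    simp only [hU, hIb, Set.mem_setOf_eq, Set.mem_union, openConn, not_and_or, not_not]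
    constructor
    · rintro (h | h)
      · exact Or.inl h.symm
      · exact Or.inr h.symm
    · rintro (h | h)
      · exact Or.inl h.symm
      · exact Or.inr h.symm
  have hmemD : ∀ K : Finset (Sym2 V), K ∈ {K : Finset (Sym2 V) | (↑K : Set (Sym2 V)) ∈ Dv} ↔ K ∉ SC := by
    intro K
    simp only [hDv, hSC, Set.mem_setOf_eq, Set.mem_compl_iff, openConn]
  have hmemX : ∀ K : Finset (Sym2 V), K ∈ {K : Finset (Sym2 V) | (↑K : Set (Sym2 V)) ∈ U ∩ Dv} ↔ K ∉ Ib ∧ K ∉ SC := by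
    intro K
    rw [← hmemU K, ← hmemD K]
    simp only [Set.mem_setOf_eq, Set.mem_inter_iff]
  have pU : ∀ K, ind {K : Finset (Sym2 V) | (↑K : Set (Sym2 V)) ∈ U} K = 1 - ind Ib K := by
    intro K
    by_cases hK : K ∈ Ib
    · rw [ind_of_mem hK, ind_of_not_mem (fun h => (hmemU K).1 h hK)]; ring
    · rw [ind_of_not_mem hK, ind_of_mem ((hmemU K).2 hK)]; ring
  have pD : ∀ K, ind {K : Finset (Sym2 V) | (↑K : Set (Sym2 V)) ∈ Dv} K = 1 - ind SC K := by
    intro K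
    by_cases hK : K ∈ SC
    · rw [ind_of_mem hK, ind_of_not_mem (fun h => (hmemD K).1 h hK)]; ring
    · rw [ind_of_not_mem hK, ind_of_mem ((hmemD K).2 hK)]; ring
  have pX : ∀ K, ind {K : Finset (Sym2 V) | (↑K : Set (Sym2 V)) ∈ U ∩ Dv} K = 1 - ind Ib K - ind SC K + ind J3 K := by
    intro K
    have hJ3' : K ∈ J3 ↔ K ∈ Ib ∧ K ∈ SC := by simp only [hJ3, hIb, hSC, Set.mem_setOf_eq]
    by_cases hK : K ∈ Ib <;> by_cases hK' : K ∈ SC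
    · rw [ind_of_mem hK, ind_of_mem hK', ind_of_mem (hJ3'.2 ⟨hK, hK'⟩),
        ind_of_not_mem (fun h => ((hmemX K).1 h).1 hK)]; ring
    · rw [ind_of_mem hK, ind_of_not_mem hK', ind_of_not_mem (fun h => hK' (hJ3'.1 h).2),
        ind_of_not_mem (fun h => ((hmemX K).1 h).1 hK)]; ring
    · rw [ind_of_not_mem hK, ind_of_mem hK', ind_of_not_mem (fun h => hK (hJ3'.1 h).1),
        ind_of_not_mem (fun h => ((hmemX K).1 h).2 hK')]; ring
    · rw [ind_of_not_mem hK, ind_of_not_mem hK', ind_of_not_mem (fun h => hK (hJ3'.1 h).1),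
        ind_of_mem ((hmemX K).2 ⟨hK, hK'⟩)]; ring
  -- `sa|c ⊔ ac|s = U ∩ D`, pointwise on indicators
  have pP : ∀ K, ind P1s K + ind P2s K = 1 - ind Ib K - ind SC K + ind J3 K := by
    intro K
    have hJ3' : K ∈ J3 ↔ K ∈ Ib ∧ K ∈ SC := by simp only [hJ3, hIb, hSC, Set.mem_setOf_eq]
    by_cases hK : K ∈ Ib
    · -- `a` isolated: neither cell
      have h1 : K ∉ P1s := fun h => hK.1 h.1.symm
      have h2 : K ∉ P2s := fun h => hK.2 h.1.symm
      by_cases hK' : K ∈ SC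
      · rw [ind_of_mem hK, ind_of_mem hK', ind_of_mem (hJ3'.2 ⟨hK, hK'⟩), ind_of_not_mem h1, ind_of_not_mem h2]; ring
      · rw [ind_of_mem hK, ind_of_not_mem hK', ind_of_not_mem (fun h => hK' (hJ3'.1 h).2), ind_of_not_mem h1,
          ind_of_not_mem h2]; ring
    · have hJ : K ∉ J3 := fun h => hK (hJ3'.1 h).1
      by_cases hK' : K ∈ SC
      · -- everything joined: neither cell
        have hsc : (openGraph (↑K : Set (Sym2 V))).Reachable s c := hK'
        have h1 : K ∉ P1s := fun h => h.2 hsc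
        have h2 : K ∉ P2s := fun h => h.2 hsc.symm
        rw [ind_of_not_mem hK, ind_of_mem hK', ind_of_not_mem hJ, ind_of_not_mem h1, ind_of_not_mem h2]; ring
      · have hsc : ¬ (openGraph (↑K : Set (Sym2 V))).Reachable s c := hK'
        have hor : (openGraph (↑K : Set (Sym2 V))).Reachable a s ∨ (openGraph (↑K : Set (Sym2 V))).Reachable a c := by
          by_contra hno
          rw [not_or] at hno
          exact hK ⟨hno.1, hno.2⟩
        rcases hor with has | hac
        · have h1 : K ∈ P1s := ⟨has.symm, hsc⟩
          have h2 : K ∉ P2s := fun h => hsc ((has.symm.trans h.1.symm))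
          rw [ind_of_not_mem hK, ind_of_not_mem hK', ind_of_not_mem hJ, ind_of_mem h1, ind_of_not_mem h2]; ring
        · have h2 : K ∈ P2s := ⟨hac.symm, fun h => hsc h.symm⟩
          have h1 : K ∉ P1s := fun h => hsc (h.1.trans hac)
          rw [ind_of_not_mem hK, ind_of_not_mem hK', ind_of_not_mem hJ, ind_of_not_mem h1, ind_of_mem h2]; ring
  -- the sums
  have hone : ∑ K ∈ Dm.powerset, wtW Dm p K = 1 := sum_wtW Dm p
  set Iv := ∑ K ∈ Dm.powerset, wtW Dm p K * ind Ib K with hIv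
  set σv := ∑ K ∈ Dm.powerset, wtW Dm p K * ind SC K with hσv
  set jv := ∑ K ∈ Dm.powerset, wtW Dm p K * ind J3 K with hjv
  set q1 := ∑ K ∈ Dm.powerset, wtW Dm p K * ind P1s K with hq1
  set q2 := ∑ K ∈ Dm.powerset, wtW Dm p K * ind P2s K with hq2
  have sU : (prodBernoulli w).real U = 1 - Iv := by
    rw [eU, hIv, ← hone, ← Finset.sum_sub_distrib]
    refine Finset.sum_congr rfl fun K _ => ?_
    rw [pU]; ring
  have sD : (prodBernoulli w).real Dv = 1 - σv := by
    rw [eD, hσv, ← hone, ← Finset.sum_sub_distrib]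
    refine Finset.sum_congr rfl fun K _ => ?_
    rw [pD]; ring
  have sX : (prodBernoulli w).real (U ∩ Dv) = 1 - Iv - σv + jv := by
    rw [eX, hIv, hσv, hjv, ← hone, ← Finset.sum_sub_distrib, ← Finset.sum_sub_distrib, ← Finset.sum_add_distrib]
    refine Finset.sum_congr rfl fun K _ => ?_
    rw [pX]; ring
  have sP : q1 + q2 = 1 - Iv - σv + jv := by
    rw [hq1, hq2, hIv, hσv, hjv, ← hone, ← Finset.sum_sub_distrib, ← Finset.sum_sub_distrib, ← Finset.sum_add_distrib,
      ← Finset.sum_add_distrib]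
    refine Finset.sum_congr rfl fun K _ => ?_
    rw [← mul_add, pP]; ring
  -- the covering bound
  have key := sum_notU_mul_sum_conn_le_of_cover hp0 hp1 s a c Φ₁ Φ₂ hΦ₁ hΦ₂ hcov
  rw [← hIv, ← hσv, ← hjv, ← hq1, ← hq2] at key
  rw [sU, sD, sX]
  nlinarith [key, sP]

/-- The first component of the swap of a valid two-configuration tree pushes the pair law forward to the configuration law
(Gladkov's Lemma 3.1 with `f = g ∘ fst`, then total mass one in the second coordinate). [cite: Gladkov2024, Lemma 3.1] -/
theorem sum_wt2W_swap2_fst (p : Sym2 V → ℝ) (T : DTree2 (Sym2 V)) (hV : Valid2 T) (g : Finset (Sym2 V) → ℝ) :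
    ∑ x ∈ (Finset.univ : Finset (Sym2 V)).powerset ×ˢ (Finset.univ : Finset (Sym2 V)).powerset,
        wt2W Finset.univ p x * g ((swap2 T x).1) =
      ∑ K ∈ (Finset.univ : Finset (Sym2 V)).powerset, wtW Finset.univ p K * g K := by
  rw [sum_wt2W_comp_swap2 (p := p) T hV Finset.univ (Finset.subset_univ _) (fun x => g x.1), Finset.sum_product]
  refine Finset.sum_congr rfl fun K _ => ?_
  simp only [wt2W]
  have h1 : ∑ C ∈ (Finset.univ : Finset (Sym2 V)).powerset, wtW Finset.univ p C = 1 := sum_wtW _ p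
  calc ∑ C ∈ (Finset.univ : Finset (Sym2 V)).powerset, wtW Finset.univ p K * wtW Finset.univ p C * g K
      = (wtW Finset.univ p K * g K) * ∑ C ∈ (Finset.univ : Finset (Sym2 V)).powerset, wtW Finset.univ p C := by
        rw [Finset.mul_sum]; exact Finset.sum_congr rfl fun C _ => by ring
    _ = wtW Finset.univ p K * g K := by rw [h1, mul_one]

/-- **THE HALVING LEMMA (v) FROM A TREE COVER.**  If two valid two-configuration decision trees `T₁, T₂` (Gladkov 2024, Def. 2.4; tree `DTree2`)
have hybrids `C₁ →_{S(T₁)} C₂ ∈ sa|c` or `C₁ →_{S(T₂)} C₂ ∈ ac|s` for EVERY pair `(C₁, C₂) = (K, C)` with `K ∈ s|a|c` and `s ↔ c` after Gladkov's swap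
along the cluster of `a`, then `μ(U)·μ(D) ≤ 2·μ(U ∩ D)` for `μ = prodBernoulli w`, every `w`.  (The combinatorial hypothesis does not mention `w`.) [this work] -/
theorem halvingUD_of_treeCover (w : Sym2 V → unitInterval) (s a c : V) (T₁ T₂ : DTree2 (Sym2 V)) (h₁ : Valid2 T₁) (h₂ : Valid2 T₂)
    (hcov : ∀ K C : Finset (Sym2 V),
      ¬ (openGraph (↑K : Set (Sym2 V))).Reachable a s → ¬ (openGraph (↑K : Set (Sym2 V))).Reachable a c →
        ¬ (openGraph (↑K : Set (Sym2 V))).Reachable s c →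
      (openGraph (↑(splice (revealedAt (Finset.univ : Finset (Sym2 V)) (∅ : Finset V) a K) C K) : Set (Sym2 V))).Reachable s c →
        ((openGraph (↑((swap2 T₁ (K, C)).1) : Set (Sym2 V))).Reachable s a ∧
            ¬ (openGraph (↑((swap2 T₁ (K, C)).1) : Set (Sym2 V))).Reachable s c) ∨
        ((openGraph (↑((swap2 T₂ (K, C)).1) : Set (Sym2 V))).Reachable c a ∧
            ¬ (openGraph (↑((swap2 T₂ (K, C)).1) : Set (Sym2 V))).Reachable c s)) :
    (prodBernoulli w).real (openConn s a ∪ openConn c a) * (prodBernoulli w).real ((openConn s c)ᶜ) ≤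
      2 * (prodBernoulli w).real ((openConn s a ∪ openConn c a) ∩ (openConn s c)ᶜ) :=
  halvingUD_of_cover w s a c (fun x => (swap2 T₁ x).1) (fun x => (swap2 T₂ x).1)
    (sum_wt2W_swap2_fst _ T₁ h₁) (sum_wt2W_swap2_fst _ T₂ h₂) hcov

/-- **One tree landing in `X`.**  If a single valid tree's hybrid lies in `sa|c ∪ ac|s` on every premise pair, (v) follows (`T₁ = T₂`). [this work] -/
theorem halvingUD_of_treeCoverX (w : Sym2 V → unitInterval) (s a c : V) (T : DTree2 (Sym2 V)) (hT : Valid2 T)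
    (hcov : ∀ K C : Finset (Sym2 V),
      ¬ (openGraph (↑K : Set (Sym2 V))).Reachable a s → ¬ (openGraph (↑K : Set (Sym2 V))).Reachable a c →
        ¬ (openGraph (↑K : Set (Sym2 V))).Reachable s c →
      (openGraph (↑(splice (revealedAt (Finset.univ : Finset (Sym2 V)) (∅ : Finset V) a K) C K) : Set (Sym2 V))).Reachable s c →
        ((openGraph (↑((swap2 T (K, C)).1) : Set (Sym2 V))).Reachable s a ∨
            (openGraph (↑((swap2 T (K, C)).1) : Set (Sym2 V))).Reachable c a) ∧
          ¬ (openGraph (↑((swap2 T (K, C)).1) : Set (Sym2 V))).Reachable s c) :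
    (prodBernoulli w).real (openConn s a ∪ openConn c a) * (prodBernoulli w).real ((openConn s c)ᶜ) ≤
      2 * (prodBernoulli w).real ((openConn s a ∪ openConn c a) ∩ (openConn s c)ᶜ) := by
  refine halvingUD_of_treeCover w s a c T T hT hT fun K C h1 h2 h3 h4 => ?_
  obtain ⟨hU, hD⟩ := hcov K C h1 h2 h3 h4
  rcases hU with hsa | hca
  · exact Or.inl ⟨hsa, hD⟩
  · exact Or.inr ⟨hca, fun h => hD h.symm⟩

end HalvingTreeCover

end Summit.CriticalPhenomena.PercolationContinuityZ3.Theorems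

end
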